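import Mathlib.Analysis.SpecificLimits.Basic
import Literature.ModelTheory.FiniteModelTheory.CohomologicalConsistency
import Literature.Computability.Cryptography.SNP
import Literature.Computability.Complexity.Reductions
import HarnessLib

/-!
# Limits of cohomological `k`-consistency: an NP-complete template is fooled at sublinear levels

(Lichter–Pago 2025, Theorem 5.9 as stated; established by Conneryd–Ghannane–Pang 2025 and
Chan–Ng 2025, see the caveat section.)

Topic `Literature/ModelTheory/FiniteModelTheory`; fact request `wi-10416` (route PneNP/DescentTower,
crux `CohConsistencyFooledByThreeCol` via the informal transfer lemma `TransferUnderGadgets`, and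
the `ℤ`-part of `JointSublinearFooling`).

Source: M. Lichter, B. Pago, *Limitations of Affine Integer Relaxations for Solving Constraint
Satisfaction Problems*, ICALP 2025 = arXiv:2407.09097; all section / theorem numbers below are
those of the arXiv version (v3): §2 (CSPs as homomorphism problems, the `k`-consistency
algorithm), §5.4 (the cohomological `k`-consistency algorithm of Ó Conghaile, reviewed),
Theorem 5.9 (= the second half of Theorem 1.2 of the introduction):

> There is an NP-complete template structure `𝔸` such that for every sublinear function in the
> instance size `k ∈ o(n)`, the cohomological `k`-consistency algorithm does not solve `CSP(𝔸)`.

(The template is the "intractable OR-construction" `OR_⊥(Γ_{ℤ₂,3}, Γ_{ℤ₃,3})` of the templates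
of ternary `ℤ₂`- and `ℤ₃`-coset-CSPs, §3.2; NP-completeness by a Karp reduction from monotone
3-SAT, Lemmas 3.18–3.19; the fooling instances are OR-glued Tseitin systems over large
3-regular 2-connected expanders, §4, accepted because robustly consistent partial solutions
survive `k(|E|)`-consistency and carry `p`-solutions with a fixed local solution, Cor. 4.13.)

## Lean rendering

* Templates and instances are finite relational structures in the tree's table format
  (`Literature.Computability.Cryptography.RelTables ar n`: Boolean tables on `Fin n` for the
  vocabulary `relLanguage ar` with arity list `ar : List ℕ`; `structureOfTables` is the
  corresponding `FirstOrder.Language.Structure`).  `HasHomTo R T` is satisfiability of the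
  instance (`Nonempty` Mathlib homomorphisms), `cspClass T` / `cspLanguage T` are `CSP(T)` as a
  class of finite instances and as a language over `Bool` (codes `encodingSNPInstance`), so that
  "NP-complete template" is the tree's `IsNPComplete (cspLanguage T)` (Karp reductions).
* "Accepted by the cohomological `k`-consistency algorithm" is Ó Conghaile's Definition 5 as
  formalised in `CohomologicalConsistency.lean` (`CohomologicallyKConsistent`), instantiated at
  the structures of the tables: `CohomologyAccepts k R T`.  The INSTANCE SIZE `n` of `⟨n, R⟩` is
  the number of elements of its universe `Fin n`, and "the algorithm with sublinear parameter
  `k : ℕ → ℕ` SOLVES `CSP(T)`" (`CohomologySolves k T`) means: an `n`-element instance is accepted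
  at level `k n` iff it is satisfiable.  Sublinearity `k ∈ o(n)` is written
  `Tendsto (fun n ↦ (k n : ℝ) / n) atTop (𝓝 0)` (the form used by route PneNP/DescentTower).
* The named fact `LichterPago2025_cohomologyFooled` is Theorem 5.9 VERBATIM in these terms (the name is
  kept because ledger items refer to it; its VALID sources are [ConnerydGhannanePang2025, Thm 6.1] and
  [ChanNg2025, Thm 1.3] = [ConnerydGhannanePang2025, Thm 7.4], not [LichterPago2025] — see the caveat
  below; the fact's cite tag names the valid primary source).
  Around it we PROVE: soundness (`CohomologyAccepts.of_hasHomTo`, from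
  `CohomologicallyKConsistent.of_hom`), EXACTNESS of every level `k ≥ |A|`
  (`KConsistent.nonempty_hom`: a non-empty restriction-closed family with the forth property
  below `k ≥ |A|` contains a total homomorphism — folklore), hence
  `not_cohomologySolves_iff` ("does not solve" = some UNSATISFIABLE instance is ACCEPTED) and the
  asymptotic reading `LichterPago2025_cohomologyFooled.frequently`: for every sublinear `k` there
  are fooling `n`-element instances for ARBITRARILY LARGE `n` (modify `k` to the identity below
  `N`; a fooling instance of size `< N` would be accepted at an exact level), and the
  constant-level form `LichterPago2025_cohomologyFooled.const` used by crux
  `CohConsistencyFooledByThreeCol` (modulo the transfer to `K₃`, which is NOT a published result).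

## Caveat: the source does not prove Theorem 5.9 for Definition 5 (recorded 2026-08-15)

The printed proof of Theorem 5.9 (p. 24 of arXiv v3) takes `𝔹 = 𝔹(𝔹₁, 𝔹₂)`, the `OR_⊥`-instance
of two unsatisfiable Tseitin systems, and the family `H` of "robustly consistent" partial
homomorphisms, and concludes "`L^k_CSP(𝔹,𝔸)` has a solution `Ψ` with `Ψ(x_{X,f}) = 1`; hence this
family is stable under the cohomological `k`-consistency algorithm" — but `Ψ` is obtained from
Cor. 4.13 via Lemma 3.17 and is a `p_i`-SOLUTION (rational, values `p_i^z`), not a `ℤ`-linear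
section.  For Ó Conghaile's algorithm (Definition 5: `ℤ`-sections supported in the CURRENT family,
greatest fixpoint — the notion `CohomologicallyKConsistent` / `CohomologyAccepts` used here, and
the one of the later literature, e.g. [ConnerydGhannanePang2025, §2.6]) these instances are in
fact REJECTED for every `k ≥ 6`: this is PROVED in `OrConstructionObstruction.lean`
(`LichterPago.orInstance_rejected`, from `OrInstance.not_cohomologicallyKConsistent`: a section with
a value `c₂` is never `ℤ`-extendable because the `S`-edges `B₁ × B₂` make every section above it
`A₁`-valued on `𝔹₁`, where integral affine averaging of a `ℤ`-section yields a homomorphism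
`𝔹₁ → 𝔸₁`; then the empty section is not `ℤ`-extendable in the surviving family either).  What the
printed argument supports is only the weaker test described in [LichterPago2025, §5.4, p. 23]
(`ℤ`-solutions of the full system `L^k_CSP(𝔹,𝔸)` fixing one local section, i.e.
`ℤ`-extendability inside `𝓗_k(𝔹,𝔸)` rather than inside the current family), for the sections
without `c`-values and after combining the `2`- and `3`-solutions by Lemma 2.2.

Consequently the named fact `LichterPago2025_cohomologyFooled` below — Theorem 5.9 AS STATED, read
with Definition 5 — is NOT established by [LichterPago2025] (review 2026-08-15, second seat, source
re-read in the arXiv v3 TeX: the algorithm box of §5.4 solves the family-restricted system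
`L^{k,𝔸}_{ℤ-aff}(𝔹, 𝓗)` in step 2(b), i.e. it IS Definition 5, and the family of the proof of
Theorem 5.9 consists of the maps induced by PAIRS of robustly consistent partial homomorphisms into
`𝔸₁`, `𝔸₂`, for which `Ψ` is neither integral nor supported in the family; for the specific template
`OR_⊥(Γ_{ℤ₂,3}, Γ_{ℤ₃,3})` the assertion of Theorem 5.9 is open).  The STATEMENT is nevertheless a
published theorem, by a different route and for different templates:
* [ConnerydGhannanePang2025, Thm 6.1] (arXiv:2511.17272, §6; SAME algorithm box as [LichterPago2025,
  §5.4]): there is an absolute constant `C` such that for `d ≥ 10` and `6d³ ≤ log n`, with high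
  probability a random `d`-regular `n`-vertex graph has chromatic number `> d / (4 log d)` but is
  ACCEPTED by cohomological `k`-consistency FOR `3`-COLOURABILITY (template `K₃`) for all
  `k ≤ n·d^{-Cd}`.  With `d` a suitable constant (e.g. `d = 100`, so that the graphs are not
  `3`-colourable) this gives, for all large `n`, non-`3`-colourable `n`-vertex graphs accepted at a
  level linear in `n`; since `CSP(K₃)` = `3`-colourability is NP-complete ([Karp1972]: CHROMATIC
  NUMBER; for three colours Stockmeyer 1973, problem [GT4] of [GareyJohnson1979]), the `∃ T`
  statement below follows with `T = K₃` (for a sublinear `k` take `n` large with `k n ≤ n·d^{-Cd}`).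
  This `K₃` form is also exactly the published base wanted by crux `CohConsistencyFooledByThreeCol` of
  route PneNP/DescentTower (no gadget transfer needed; `graphCohomologicallyKConsistent_iff` in
  `CohomologicalConsistency.lean` bridges simple graphs and the model-theoretic notion).
* [ChanNg2025, Thm 1.3], re-proved as [ConnerydGhannanePang2025, Thm 7.4]: for every `r`-uniform
  template that is lax, null-constraining and not trivially satisfiable — e.g. `r`-uniform hypergraph
  `c`-colouring, `r ≥ 3`, `c ≥ 2`, NP-complete for `(r, c) = (3, 2)` — random instances with `Δn`
  constraints are unsatisfiable with high probability but accepted by cohomological `k`-consistency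
  for all `k ≤ ζn` with probability `≥ δ - o(1)`.
Neither proof (random regular graphs / random hypergraphs, closure operators, the polynomial-calculus
degree machinery behind Alekhnovich–Razborov pseudo-reduction operators) is formalised here; the fact
is cited to [ConnerydGhannanePang2025, Thm 6.1] as its primary valid source and keeps its historical
name.

## What is NOT here

* The first half of Theorem 1.2 / Theorem 5.8 (the tractable OR-construction
  `OR_T(Γ_{ℤ₂,3}, Γ_{ℤ₃,3})`, the 7-element Maltsev template of Theorem 1.1, IS solved by
  cohomological `k`-consistency for every `k ≥ 4`) and Theorem 1.1 itself (that template fools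
  `ℤ`-affine `k`-consistency, BLP+AIP, BA^k and CLAP for `k ∈ o(n)`): both need the
  OR-construction, coset-CSP templates and the four affine algorithms as Lean definitions, and no
  statement in the tree consumes them.
* "Fooling instances of EVERY large size `n`" (an `∀ᶠ n` form): the printed theorem gives
  instances on all large members of an expander family (sizes `Θ(n)`), not a padding argument;
  we vendor only what is printed and what follows from it formally (`frequently`).
* The transfer of fooling instances along gadget / pp-constructions (e.g. to 3-colouring): not
  in the source (their open question, p. 5, asks for tractable templates; `K₃` is NP-complete but
  no transfer theorem for cohomological consistency is in print).
-/

namespace Literature.ModelTheory.FiniteModelTheory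

open _root_.Filter
open scoped _root_.Topology
open scoped FirstOrder
open Literature.Computability.Cryptography (relLanguage RelTables structureOfTables SNPInstance
  encodingSNPInstance)
open Literature.Computability.Complexity (IsNPComplete)

universe u v

/-! ### Exactness of the consistency levels `k ≥ |A|` -/

section Exact

variable {L : FirstOrder.Language} {k : ℕ} {A : Type u} {B : Type v} [L.Structure A]
  [L.Structure B] [DecidableEq A]

/-- EXACTNESS OF `k`-CONSISTENCY AT LEVEL `k ≥ |A|` (relational signature, finite instance): a
non-empty restriction-closed family of partial homomorphisms on `≤ k`-element contexts with the
forth property below `k` contains a section over every context (induction on the context, one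
forth step per new element — possible as long as the context has `< |A| ≤ k` elements), in
particular over the whole universe, and a partial homomorphism defined everywhere is a
homomorphism.  So the `k`-consistency algorithm with `k ≥ |A|` accepts only satisfiable
instances. [folklore] -/
theorem KConsistent.nonempty_hom [L.IsRelational] [Fintype A] (h : KConsistent L k A B)
    (hk : Fintype.card A ≤ k) : Nonempty (A →[L] B) := by
  obtain ⟨S, hS, ⟨U, s, hs⟩, hdc, hforth⟩ := h
  have key : ∀ C : Finset A, (S C).Nonempty := by
    intro C
    induction C using Finset.induction_on with
    | empty => exact ⟨_, hdc (Finset.empty_subset U) hs⟩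
    | insert a C ha ih =>
      obtain ⟨t, ht⟩ := ih
      have hC : C.card < k :=
        lt_of_lt_of_le (Finset.card_lt_card (Finset.ssubset_insert ha))
          ((Finset.card_le_univ _).trans hk)
      obtain ⟨t', ht', -⟩ := hforth ht hC a
      exact ⟨t', ht'⟩
  obtain ⟨t, ht⟩ := key Finset.univ
  exact ⟨⟨fun a => t ⟨a, Finset.mem_univ a⟩, fun {n} f => isEmptyElim f,
    fun {n} r x hx => (hS _ ht).2 r (fun i => ⟨x i, Finset.mem_univ _⟩) hx⟩⟩

/-- EXACTNESS OF COHOMOLOGICAL `k`-CONSISTENCY AT LEVEL `k ≥ |A|`: an instance accepted at a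
level `k ≥ |A|` maps homomorphically to the template (cohomological `k`-consistency refines
`k`-consistency, `CohomologicallyKConsistent.kConsistent`, which is exact there). [folklore] -/
theorem CohomologicallyKConsistent.nonempty_hom [L.IsRelational] [Fintype A]
    (h : CohomologicallyKConsistent L k A B) (hk : Fintype.card A ≤ k) : Nonempty (A →[L] B) :=
  h.kConsistent.nonempty_hom hk

end Exact

/-! ### `CSP(T)` for a finite template `T` -/

section CSP

variable {ar : List ℕ} {n m : ℕ}

/-- SATISFIABILITY of the instance `R` (tables on `Fin n`) w.r.t. the template `T` (tables on
`Fin m`) of the same finite relational vocabulary `relLanguage ar`: there is a homomorphism of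
`relLanguage ar`-structures `structureOfTables R → structureOfTables T` (Mathlib
`FirstOrder.Language.Hom`; unfolded in `hasHomTo_iff`). [cite: LichterPago2025, §2] -/
def HasHomTo (R : RelTables ar n) (T : RelTables ar m) : Prop :=
  Nonempty (@FirstOrder.Language.Hom (relLanguage ar) (Fin n) (Fin m) (structureOfTables R)
    (structureOfTables T))

/-- Unfolding `HasHomTo`: a homomorphism is a map `f : Fin n → Fin m` sending every tuple in a
relation of the instance to a tuple in the same relation of the template.
[cite: LichterPago2025, §2] -/
theorem hasHomTo_iff (R : RelTables ar n) (T : RelTables ar m) :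
    HasHomTo R T ↔ ∃ f : Fin n → Fin m,
      ∀ (i : Fin ar.length) (v : Fin (ar.get i) → Fin n), R i v = true → T i (f ∘ v) = true := by
  constructor
  · rintro ⟨F⟩
    refine ⟨F, fun i v hv => ?_⟩
    exact @FirstOrder.Language.Hom.map_rel (relLanguage ar) (Fin n) (Fin m) (structureOfTables R)
      (structureOfTables T) F (ar.get i) ⟨i, rfl⟩ v hv
  · rintro ⟨f, hf⟩
    refine ⟨@FirstOrder.Language.Hom.mk (relLanguage ar) (Fin n) (Fin m) (structureOfTables R)
      (structureOfTables T) f (fun {l} g => isEmptyElim g) ?_⟩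
    rintro l ⟨i, rfl⟩ v hv
    exact hf i _ hv

/-- `CSP(T)`, the CONSTRAINT SATISFACTION PROBLEM WITH TEMPLATE `T`, as a class of finite
instances: the finite `relLanguage ar`-structures `⟨n, R⟩` (universe `Fin n`, tables `R`) that map
homomorphically to `T`. [cite: LichterPago2025, §2] -/
def cspClass (T : RelTables ar m) : Set (SNPInstance ar) :=
  {x | HasHomTo x.2 T}

/-- Membership in `cspClass T` is satisfiability. [cite: LichterPago2025, §2] -/
@[simp] theorem mem_cspClass_iff (T : RelTables ar m) (x : SNPInstance ar) :
    x ∈ cspClass T ↔ HasHomTo x.2 T :=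
  Iff.rfl

/-- `CSP(T)` as a LANGUAGE over `Bool`: the codes (`encodingSNPInstance ar`: universe size, then
the relation tables as bits) of the satisfiable finite instances.  This is the decision problem
whose NP-completeness "an NP-complete template" refers to (`IsNPComplete`, Karp reductions).
[cite: LichterPago2025, §2] -/
def cspLanguage (T : RelTables ar m) : Language Bool :=
  (encodingSNPInstance ar).toLanguage (cspClass T)

/-- The code of an instance lies in `cspLanguage T` iff the instance is satisfiable.
[cite: LichterPago2025, §2] -/
@[simp] theorem encode_mem_cspLanguage_iff (T : RelTables ar m) (x : SNPInstance ar) :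
    (encodingSNPInstance ar).encode x ∈ cspLanguage T ↔ HasHomTo x.2 T :=
  Computability.Encoding.mem_toLanguage_iff _ _ _

/-! ### Acceptance by the cohomological `k`-consistency algorithm -/

/-- The instance `R` is ACCEPTED BY THE COHOMOLOGICAL `k`-CONSISTENCY ALGORITHM w.r.t. the template
`T`: Ó Conghaile's `A →^ℤ_k B` (Definition 5, `CohomologicallyKConsistent`: the greatest fixpoint
of "keep a `k`-local partial homomorphism iff it has the forth property and is `ℤ`-extendable"
is non-empty) for the structures of the tables. [cite: OConghaile2022, Def. 5] -/
def CohomologyAccepts (k : ℕ) (R : RelTables ar n) (T : RelTables ar m) : Prop :=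
  @CohomologicallyKConsistent (relLanguage ar) k (Fin n) (Fin m) (structureOfTables R)
    (structureOfTables T) _

/-- SOUNDNESS: satisfiable instances are accepted at every level ("All of the affine algorithms
are sound: they accept all yes-instances"). [cite: LichterPago2025, §5] -/
theorem CohomologyAccepts.of_hasHomTo {k : ℕ} {R : RelTables ar n} {T : RelTables ar m}
    (h : HasHomTo R T) : CohomologyAccepts k R T := by
  obtain ⟨F⟩ := h
  exact @CohomologicallyKConsistent.of_hom (relLanguage ar) k (Fin n) (Fin m) (structureOfTables R)
    (structureOfTables T) _ F

/-- EXACTNESS: an `n`-element instance accepted at a level `k ≥ n` is satisfiable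
(`CohomologicallyKConsistent.nonempty_hom`). [folklore] -/
theorem CohomologyAccepts.hasHomTo_of_le {k : ℕ} {R : RelTables ar n} {T : RelTables ar m}
    (h : CohomologyAccepts k R T) (hk : n ≤ k) : HasHomTo R T :=
  @CohomologicallyKConsistent.nonempty_hom (relLanguage ar) k (Fin n) (Fin m) (structureOfTables R)
    (structureOfTables T) _ _ _ h (by simpa using hk)

/-- The cohomological `k`-consistency algorithm, run with the (possibly growing) width parameter
`k : ℕ → ℕ` — level `k n` on instances with `n` elements — SOLVES `CSP(T)`: it accepts exactly
the satisfiable instances. [cite: LichterPago2025, §5.4] -/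
def CohomologySolves (k : ℕ → ℕ) (T : RelTables ar m) : Prop :=
  ∀ (n : ℕ) (R : RelTables ar n), CohomologyAccepts (k n) R T ↔ HasHomTo R T

/-- By soundness, "does not solve" means: some UNSATISFIABLE instance is ACCEPTED (at the level
of its own size). [cite: LichterPago2025, §5] -/
theorem not_cohomologySolves_iff (k : ℕ → ℕ) (T : RelTables ar m) :
    ¬ CohomologySolves k T ↔
      ∃ (n : ℕ) (R : RelTables ar n), ¬ HasHomTo R T ∧ CohomologyAccepts (k n) R T := by
  constructor
  · intro h
    by_contra hne
    refine h fun n R => ⟨fun hacc => ?_, CohomologyAccepts.of_hasHomTo⟩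
    by_contra hno
    exact hne ⟨n, R, hno, hacc⟩
  · rintro ⟨n, R, hno, hacc⟩ h
    exact hno ((h n R).1 hacc)


/-- Levels at or above the instance size are exact, so WITHOUT the sublinearity hypothesis the
algorithm trivially "solves" every CSP: if `n ≤ k n` for all `n` then `CohomologySolves k T`
(soundness + `CohomologyAccepts.hasHomTo_of_le`).  Non-vacuity guard for the hypothesis
`k ∈ o(n)` of Theorem 5.9. [folklore] -/
theorem cohomologySolves_of_le {k : ℕ → ℕ} (hk : ∀ n, n ≤ k n) (T : RelTables ar m) :
    CohomologySolves k T :=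
  fun n _ => ⟨fun h => h.hasHomTo_of_le (hk n), CohomologyAccepts.of_hasHomTo⟩

end CSP

/-! ### Theorem 5.9 -/

/-- **An NP-complete template fools cohomological `k`-consistency at every sublinear level.**
There is an NP-complete finite template — a finite relational vocabulary (arity list `ar`) and a
finite `relLanguage ar`-structure `T` on `Fin m` with `CSP(T)` NP-complete — such that for every
function `k : ℕ → ℕ` that is sublinear in the instance size (`k(n)/n → 0`), the cohomological
`k`-consistency algorithm (level `k n` on `n`-element instances, acceptance = Ó Conghaile's
Definition 5) does NOT solve `CSP(T)`.
SOURCES.  This is a consequence of [ConnerydGhannanePang2025, Thm 6.1] with `T = K₃`: for `d ≥ 10`,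
`6d³ ≤ log n`, with high probability a random `d`-regular `n`-vertex graph has chromatic number
`> d/(4 log d)` (so `> 3` for a suitable constant `d`) but is accepted by cohomological
`k`-consistency for `3`-colourability for all `k ≤ n·d^{-Cd}` (`C` absolute), while `3`-colourability
is NP-complete ([Karp1972]; Stockmeyer 1973 = [GT4] of [GareyJohnson1979]); given a sublinear `k`, take
`n` large with `k n ≤ n·d^{-Cd}`.  It also
follows from [ChanNg2025, Thm 1.3] = [ConnerydGhannanePang2025, Thm 7.4] (random instances of any lax,
null-constraining, not trivially satisfiable uniform template, e.g. `3`-uniform hypergraph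
`2`-colouring, are unsatisfiable but accepted for all `k ≤ ζn`).  HISTORY / CAVEAT: the statement was
vendored as [LichterPago2025, Thm 5.9 (= Thm 1.2, second half)] VERBATIM and keeps that name (ledger
items refer to it), but the proof printed there does not establish it: its fooling instances, the
`OR_⊥`-instances of two unsatisfiable Tseitin systems, are REJECTED by the algorithm for every `k ≥ 6`
(`LichterPago.orInstance_rejected` in `OrConstructionObstruction.lean`; details in the module
docstring).  Neither valid proof (random graphs / hypergraphs, pseudo-reduction operators) is
formalised here.
Consequences proved below: `not_cohomologySolves_iff` (an unsatisfiable accepted instance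
exists), `.frequently` (such instances exist with arbitrarily many elements), `.const` (every
constant level is fooled infinitely often). [cite: ConnerydGhannanePang2025, Thm 6.1] -/
def LichterPago2025_cohomologyFooled : Prop :=
  ∃ (ar : List ℕ) (m : ℕ) (T : RelTables ar m), IsNPComplete (cspLanguage T) ∧
    ∀ k : ℕ → ℕ, Tendsto (fun n : ℕ => (k n : ℝ) / n) atTop (𝓝 0) → ¬ CohomologySolves k T

/-- THE ASYMPTOTIC READING of Theorem 5.9, derived formally: for every sublinear `k` and every
bound `N` there is an unsatisfiable instance with `n ≥ N` elements accepted at level `k n`.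
(Apply the theorem to `k'` = the identity below `N` and `k` from `N` on, still sublinear; a
fooling instance with `n < N` elements would be accepted at the exact level `k' n = n`,
`CohomologyAccepts.hasHomTo_of_le`.) [cite: ConnerydGhannanePang2025, Thm 6.1] -/
theorem LichterPago2025_cohomologyFooled.frequently (h : LichterPago2025_cohomologyFooled) :
    ∃ (ar : List ℕ) (m : ℕ) (T : RelTables ar m), IsNPComplete (cspLanguage T) ∧
      ∀ k : ℕ → ℕ, Tendsto (fun n : ℕ => (k n : ℝ) / n) atTop (𝓝 0) →
        ∀ N : ℕ, ∃ n ≥ N, ∃ R : RelTables ar n, ¬ HasHomTo R T ∧ CohomologyAccepts (k n) R T := by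
  obtain ⟨ar, m, T, hNP, hk⟩ := h
  refine ⟨ar, m, T, hNP, fun k hk0 N => ?_⟩
  have hk' : Tendsto (fun n : ℕ => ((if n < N then n else k n : ℕ) : ℝ) / n) atTop (𝓝 0) := by
    refine hk0.congr' ?_
    filter_upwards [eventually_ge_atTop N] with n hn
    rw [if_neg (not_lt.2 hn)]
  obtain ⟨n, R, hno, hacc⟩ := (not_cohomologySolves_iff _ T).1 (hk _ hk')
  by_cases hn : n < N
  · have hacc' : CohomologyAccepts n R T := by simpa [hn] using hacc
    exact (hno (hacc'.hasHomTo_of_le le_rfl)).elim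
  · exact ⟨n, not_lt.1 hn, R, hno, by simpa [hn] using hacc⟩

/-- THE CONSTANT-LEVEL FORM: for every fixed level `k₀` there are unsatisfiable instances of the
NP-complete template with arbitrarily many elements accepted by cohomological `k₀`-consistency
(a constant function is sublinear).  For crux `CohConsistencyFooledByThreeCol` of route
PneNP/DescentTower note that [ConnerydGhannanePang2025, Thm 6.1] gives the `K₃` case directly
(non-`3`-colourable random regular graphs accepted at linear level), so no transfer from another
template is needed there. [cite: ConnerydGhannanePang2025, Thm 6.1] -/
theorem LichterPago2025_cohomologyFooled.const (h : LichterPago2025_cohomologyFooled) :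
    ∃ (ar : List ℕ) (m : ℕ) (T : RelTables ar m), IsNPComplete (cspLanguage T) ∧
      ∀ k₀ N : ℕ, ∃ n ≥ N, ∃ R : RelTables ar n, ¬ HasHomTo R T ∧ CohomologyAccepts k₀ R T := by
  obtain ⟨ar, m, T, hNP, hk⟩ := h.frequently
  exact ⟨ar, m, T, hNP, fun k₀ N => hk (fun _ => k₀) (tendsto_const_div_atTop_nhds_zero_nat _) N⟩

end Literature.ModelTheory.FiniteModelTheory
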